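import Summits.KontsevichZagierPeriods.Zeta5Search.Certificates.RayH1Growth
import HarnessLib

/-!
# ζ(5) search — certificates: the growth of `Q(a·n)` on the ray RayH1 — II: upper bound and rates
(cell `pub-zeta5`, P1 g11; port of certifier 2's `Certificates/RecordRayGrowthUpper.lean`)

HONEST FRAMING: systematic search; no irrationality claim unless certified.

OUR work (Summit side). Continuation of `Certificates/RayH1Growth.lean` (`a = (7,13,9,12,11,15,17,12)`):

* `abs_h1Q_le` — `|Q(a·n)| ≤ (12n+1)(7n+1)·exp(n·A₀)` for every `n`, `A₀ = growthSup` = the Chernoff (tangent-plane) bound at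
  the rational slopes `t1,…,t7` below (five `10⁻⁴`-roundings of the maximiser's ratios, two SOLVED from the stationarity
  relations `slope_rel₁/₂` so that the bound does not depend on `(k₁,k₂)`); `growthSup_le` : `A₀ ≤ 72.9346`
  (model supremum of the entropy `72.9344`; `A₀ = 72.9344280`);
* RATES: `eventually_exp_le_abs_h1Q` (`∀ ε>0, ∀ᶠ n, e^{(72.9015−ε)n} ≤ |Q(a·n)|`) and `eventually_abs_h1Q_le_exp`
  (`∀ ε>0, ∀ᶠ n, |Q(a·n)| ≤ e^{(72.9346+ε)n}`); `rate_mem_of_tendsto` — any limit of `log|Q(a·n)|/n` lies in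
  `[72.9015, 72.9346]` (the census MODEL value is `C₁ = 72.9344`).
-/

noncomputable section

open Finset Real Filter Topology

namespace Summit.KontsevichZagierPeriods.Zeta5Search.RayH1

open Summit.KontsevichZagierPeriods.Zeta5Search.BinomialSum
open Summit.KontsevichZagierPeriods.Zeta5Search.LogEnclosures
open Summit.KontsevichZagierPeriods.Zeta5Search.RecordRay (eventually_log_linear_le)
open Literature.NumberTheory.Irrationality.BrownZudilin2022 (zchoose Qcoeff QOf pOf qOf)

/-! ### Upper bound: the Chernoff bound at fixed rational slopes -/

/-- Slope `t1` for the first binomial of `qTerm` (rational approximation of the maximiser ratio; `≈ 0.644100`). -/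
def t1 : ℝ := 6441 / 10000
/-- Slope `t2` for the second binomial of `qTerm` (rational approximation of the maximiser ratio; `≈ 0.522500`). -/
def t2 : ℝ := 209 / 400
/-- Slope `t3` for the third binomial of `qTerm` (rational approximation of the maximiser ratio; `≈ 0.336000`). -/
def t3 : ℝ := 42 / 125
/-- Slope `t4` for the fourth binomial of `qTerm` (rational approximation of the maximiser ratio; `≈ 0.728100`). -/
def t4 : ℝ := 7281 / 10000
/-- Slope `t5` for the fifth binomial of `qTerm` (SOLVED from a stationarity relation; `≈ 0.612439`). -/
def t5 : ℝ := 3398750000 / 5549535557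
/-- Slope `t6` for the sixth binomial of `qTerm` (rational approximation of the maximiser ratio; `≈ 0.579000`). -/
def t6 : ℝ := 579 / 1000
/-- Slope `t7` for the seventh binomial of `qTerm` (SOLVED from a stationarity relation; `≈ 0.696354`). -/
def t7 : ℝ := 21050000 / 30228887

/-- All slopes lie in `(0,1)`. -/
theorem slopes_mem : (0 < t1 ∧ t1 < 1) ∧ (0 < t2 ∧ t2 < 1) ∧ (0 < t3 ∧ t3 < 1) ∧ (0 < t4 ∧ t4 < 1) ∧ (0 < t5 ∧ t5 < 1)
    ∧ (0 < t6 ∧ t6 < 1) ∧ (0 < t7 ∧ t7 < 1) := by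
  unfold t1 t2 t3 t4 t5 t6 t7; norm_num

/-- The `n`-coefficient of the Chernoff exponent at the slopes (`= 72.934427988…`). -/
def growthSup : ℝ :=
  14 * (-Real.log t1) - 14 * (-Real.log (1 - t1)) + 11 * (-Real.log t2) - 11 * (-Real.log (1 - t2)) + 9 * (-Real.log t3) - 25 * (-Real.log (1 - t3)) - 13 * (-Real.log t4) + 25 * (-Real.log (1 - t4)) - 15 * (-Real.log t5) + 26 * (-Real.log (1 - t5)) - 17 * (-Real.log t6) + 24 * (-Real.log (1 - t6)) - 12 * (-Real.log t7) + 25 * (-Real.log (1 - t7))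

/-- **First stationarity relation** (the `k₁`-coefficient of the exponent vanishes):
`(1−t4)(1−t5) = (1−t1)(1−t3)t4t5`, in logarithms. -/
theorem slope_rel₁ :
    -Real.log (1 - t1) - Real.log (1 - t3) - Real.log t4 + Real.log (1 - t4) - Real.log t5 + Real.log (1 - t5) = 0 := by
  have key : Real.log ((1 - t4) * (1 - t5)) = Real.log ((1 - t1) * (1 - t3) * t4 * t5) := by
    congr 1; unfold t1 t3 t4 t5; norm_num
  have h1 : (1 : ℝ) - t1 ≠ 0 := by unfold t1; norm_num
  have h3 : (1 : ℝ) - t3 ≠ 0 := by unfold t3; norm_num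
  have h4 : t4 ≠ 0 := by unfold t4; norm_num
  have h4' : (1 : ℝ) - t4 ≠ 0 := by unfold t4; norm_num
  have h5 : t5 ≠ 0 := by unfold t5; norm_num
  have h5' : (1 : ℝ) - t5 ≠ 0 := by unfold t5; norm_num
  rw [Real.log_mul h4' h5', Real.log_mul (by positivity) h5, Real.log_mul (by positivity) h4,
    Real.log_mul h1 h3] at key
  linarith

/-- **Second stationarity relation** (the `k₂`-coefficient vanishes): `(1−t6)(1−t7) = (1−t2)(1−t3)t6t7`. -/
theorem slope_rel₂ :
    -Real.log (1 - t2) - Real.log (1 - t3) - Real.log t6 + Real.log (1 - t6) - Real.log t7 + Real.log (1 - t7) = 0 := by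
  have key : Real.log ((1 - t6) * (1 - t7)) = Real.log ((1 - t2) * (1 - t3) * t6 * t7) := by
    congr 1; unfold t2 t3 t6 t7; norm_num
  have h2 : (1 : ℝ) - t2 ≠ 0 := by unfold t2; norm_num
  have h3 : (1 : ℝ) - t3 ≠ 0 := by unfold t3; norm_num
  have h6 : t6 ≠ 0 := by unfold t6; norm_num
  have h6' : (1 : ℝ) - t6 ≠ 0 := by unfold t6; norm_num
  have h7 : t7 ≠ 0 := by unfold t7; norm_num
  have h7' : (1 : ℝ) - t7 ≠ 0 := by unfold t7; norm_num
  rw [Real.log_mul h6' h7', Real.log_mul (by positivity) h7, Real.log_mul (by positivity) h6,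
    Real.log_mul h2 h3] at key
  linarith

/-- **Every term of (17) on the ray is `≤ exp(n·A₀)`** (Chernoff bound; the `(k₁,k₂)`-dependence cancels by the two
stationarity relations). -/
theorem qTerm_h1_le (n : ℕ) (k₁ k₂ : ℤ) :
    (qTerm (pRayH1 n) (qRayH1 n) k₁ k₂ : ℝ) ≤ Real.exp ((n : ℝ) * growthSup) := by
  obtain ⟨h₁, h₂, h₃, h₄, h₅, h₆, h₇⟩ := slopes_mem
  have h := qTerm_le_exp (pRayH1 n) (qRayH1 n) k₁ k₂ h₁ h₂ h₃ h₄ h₅ h₆ h₇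
  simp only [pRayH1_0, pRayH1_1, pRayH1_2, pRayH1_3, pRayH1_4, pRayH1_5, pRayH1_6, qRayH1_0, qRayH1_1, qRayH1_2, qRayH1_3, qRayH1_4] at h
  push_cast at h
  refine h.trans (le_of_eq ?_)
  congr 1
  unfold growthSup
  linear_combination ((k₁ : ℝ)) * slope_rel₁ + ((k₂ : ℝ)) * slope_rel₂

/-- **Upper bound for every `n`**: `|Q(a·n)| ≤ (12n+1)(7n+1)·exp(n·A₀)`. -/
theorem abs_h1Q_le (n : ℕ) :
    |(h1Q n : ℝ)| ≤ (12 * (n : ℝ) + 1) * (7 * (n : ℝ) + 1) * Real.exp ((n : ℝ) * growthSup) := by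
  rw [h1Q_eq_Qcoeff]
  have h := abs_Qcoeff_le_of_forall (pRayH1 n) (qRayH1 n) (by rw [qRayH1_0]; positivity) (by rw [qRayH1_3]; positivity)
    (B := Real.exp ((n : ℝ) * growthSup)) (fun k₁ _ k₂ _ => qTerm_h1_le n k₁ k₂)
  simp only [qRayH1_0, qRayH1_3] at h
  push_cast at h
  exact h

/-- **`A₀ ≤ 72.9346`** (certified logarithms). -/
theorem growthSup_le : growthSup ≤ 364673 / 5000 := by
  have l1 : Real.log t1 = Real.log 6441 - Real.log 10000 := by
    unfold t1; exact Real.log_div (by norm_num) (by norm_num)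
  have l1' : Real.log (1 - t1) = Real.log 3559 - Real.log 10000 := by
    unfold t1; rw [show (1 : ℝ) - 6441 / 10000 = 3559 / 10000 by norm_num]; exact Real.log_div (by norm_num) (by norm_num)
  have l2 : Real.log t2 = Real.log 209 - Real.log 400 := by
    unfold t2; exact Real.log_div (by norm_num) (by norm_num)
  have l2' : Real.log (1 - t2) = Real.log 191 - Real.log 400 := by
    unfold t2; rw [show (1 : ℝ) - 209 / 400 = 191 / 400 by norm_num]; exact Real.log_div (by norm_num) (by norm_num)
  have l3 : Real.log t3 = Real.log 42 - Real.log 125 := by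
    unfold t3; exact Real.log_div (by norm_num) (by norm_num)
  have l3' : Real.log (1 - t3) = Real.log 83 - Real.log 125 := by
    unfold t3; rw [show (1 : ℝ) - 42 / 125 = 83 / 125 by norm_num]; exact Real.log_div (by norm_num) (by norm_num)
  have l4 : Real.log t4 = Real.log 7281 - Real.log 10000 := by
    unfold t4; exact Real.log_div (by norm_num) (by norm_num)
  have l4' : Real.log (1 - t4) = Real.log 2719 - Real.log 10000 := by
    unfold t4; rw [show (1 : ℝ) - 7281 / 10000 = 2719 / 10000 by norm_num]; exact Real.log_div (by norm_num) (by norm_num)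
  have l5 : Real.log t5 = Real.log 2719 + Real.log 10000 + Real.log 125 - Real.log 5549535557 := by
    unfold t5
    rw [Real.log_div (by norm_num) (by norm_num), show (3398750000 : ℝ) = 2719 * 10000 * 125 by norm_num,
      Real.log_mul (by norm_num) (by norm_num), Real.log_mul (by norm_num) (by norm_num)]
  have l5' : Real.log (1 - t5) = Real.log 3559 + Real.log 83 + Real.log 7281 - Real.log 5549535557 := by
    unfold t5
    rw [show (1 : ℝ) - 3398750000 / 5549535557 = 3559 * 83 * 7281 / 5549535557 by norm_num,
      Real.log_div (by norm_num) (by norm_num), Real.log_mul (by norm_num) (by norm_num),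
      Real.log_mul (by norm_num) (by norm_num)]
  have l6 : Real.log t6 = Real.log 579 - Real.log 1000 := by
    unfold t6; exact Real.log_div (by norm_num) (by norm_num)
  have l6' : Real.log (1 - t6) = Real.log 421 - Real.log 1000 := by
    unfold t6; rw [show (1 : ℝ) - 579 / 1000 = 421 / 1000 by norm_num]; exact Real.log_div (by norm_num) (by norm_num)
  have l7 : Real.log t7 = Real.log 421 + Real.log 400 + Real.log 125 - Real.log 30228887 := by
    unfold t7
    rw [Real.log_div (by norm_num) (by norm_num), show (21050000 : ℝ) = 421 * 400 * 125 by norm_num,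
      Real.log_mul (by norm_num) (by norm_num), Real.log_mul (by norm_num) (by norm_num)]
  have l7' : Real.log (1 - t7) = Real.log 191 + Real.log 83 + Real.log 579 - Real.log 30228887 := by
    unfold t7
    rw [show (1 : ℝ) - 21050000 / 30228887 = 191 * 83 * 579 / 30228887 by norm_num,
      Real.log_div (by norm_num) (by norm_num), Real.log_mul (by norm_num) (by norm_num),
      Real.log_mul (by norm_num) (by norm_num)]
  unfold growthSup
  rw [l1, l1', l2, l2', l3, l3', l4, l4', l5, l5', l6, l6', l7, l7']
  obtain ⟨lo0, hi0⟩ := log_6441_bounds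
  obtain ⟨lo1, hi1⟩ := log_3559_bounds
  obtain ⟨lo2, hi2⟩ := log_10000_bounds
  obtain ⟨lo3, hi3⟩ := log_209_bounds
  obtain ⟨lo4, hi4⟩ := log_191_bounds
  obtain ⟨lo5, hi5⟩ := log_400_bounds
  obtain ⟨lo6, hi6⟩ := log_42_bounds
  obtain ⟨lo7, hi7⟩ := log_83_bounds
  obtain ⟨lo8, hi8⟩ := log_125_bounds
  obtain ⟨lo9, hi9⟩ := log_7281_bounds
  obtain ⟨lo10, hi10⟩ := log_2719_bounds
  obtain ⟨lo11, hi11⟩ := log_579_bounds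
  obtain ⟨lo12, hi12⟩ := log_421_bounds
  obtain ⟨lo13, hi13⟩ := log_1000_bounds
  obtain ⟨lo14, hi14⟩ := log_5549535557_bounds
  obtain ⟨lo15, hi15⟩ := log_30228887_bounds
  linarith

/-! ### Rates -/

/-- **Upper rate**: `∀ ε > 0`, `|Q(a·n)| ≤ e^{(72.9346 + ε)n}` for all large `n`. -/
theorem eventually_abs_h1Q_le_exp {ε : ℝ} (hε : 0 < ε) :
    ∀ᶠ n : ℕ in atTop, |(h1Q n : ℝ)| ≤ Real.exp ((364673 / 5000 + ε) * n) := by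
  filter_upwards [eventually_log_linear_le (a := 12) (b := 1) (by norm_num) (by norm_num) (half_pos hε),
    eventually_log_linear_le (a := 7) (b := 1) (by norm_num) (by norm_num) (half_pos hε)] with n hA hB
  refine (abs_h1Q_le n).trans ?_
  have hA0 := growthSup_le
  have hn : (0 : ℝ) ≤ n := Nat.cast_nonneg n
  rw [← Real.exp_log (show (0 : ℝ) < 12 * n + 1 by positivity), ← Real.exp_log (show (0 : ℝ) < 7 * n + 1 by positivity),
    ← Real.exp_add, ← Real.exp_add]
  apply Real.exp_le_exp.mpr
  nlinarith

/-- **Lower rate**: `∀ ε > 0`, `e^{(72.9015 − ε)n} ≤ |Q(a·n)|` for all large `n`. -/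
theorem eventually_exp_le_abs_h1Q {ε : ℝ} (hε : 0 < ε) :
    ∀ᶠ n : ℕ in atTop, Real.exp ((145803 / 2000 - ε) * n) ≤ |(h1Q n : ℝ)| := by
  filter_upwards [eventually_log_linear_le (a := 27) (b := 0) (by norm_num) le_rfl (show (0 : ℝ) < ε / 7 by positivity),
    eventually_ge_atTop 1, tendsto_natCast_atTop_atTop.eventually_ge_atTop (28 / ε)] with n hlog hn1 hn2
  have hlow := abs_h1Q_ge hn1
  have hE := growthEnt_ge
  have hn : (0 : ℝ) ≤ n := Nat.cast_nonneg n
  rw [add_zero] at hlog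
  have h14 : (14 : ℝ) ≤ ε / 2 * n := by
    rw [div_le_iff₀ hε] at hn2; nlinarith
  rw [← Real.exp_log (latticeTerm_le_abs_h1Q n).2]
  apply Real.exp_le_exp.mpr
  nlinarith

/-- **Any limit of `log|Q(a·n)|/n` lies in `[72.9015, 72.9346]`** (no hypothesis). -/
theorem rate_mem_of_tendsto {c : ℝ} (h : Tendsto (fun n : ℕ => Real.log |(h1Q n : ℝ)| / n) atTop (𝓝 c)) :
    (145803 / 2000 : ℝ) ≤ c ∧ c ≤ 364673 / 5000 := by
  constructor
  · refine le_of_forall_pos_le_add fun ε hε => ?_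
    have hev : ∀ᶠ n : ℕ in atTop, (145803 / 2000 : ℝ) - ε ≤ Real.log |(h1Q n : ℝ)| / n := by
      filter_upwards [eventually_exp_le_abs_h1Q hε, eventually_ge_atTop 1] with n hn hn1
      have hnpos : (0 : ℝ) < n := by exact_mod_cast hn1
      rw [le_div_iff₀ hnpos]
      have := Real.log_le_log (Real.exp_pos _) hn
      rwa [Real.log_exp] at this
    have := ge_of_tendsto h hev
    linarith
  · refine le_of_forall_pos_le_add fun ε hε => ?_
    have hev : ∀ᶠ n : ℕ in atTop, Real.log |(h1Q n : ℝ)| / n ≤ 364673 / 5000 + ε := by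
      filter_upwards [eventually_abs_h1Q_le_exp hε, eventually_ge_atTop 1] with n hn hn1
      have hnpos : (0 : ℝ) < n := by exact_mod_cast hn1
      rw [div_le_iff₀ hnpos]
      have := Real.log_le_log (latticeTerm_le_abs_h1Q n).2 hn
      rwa [Real.log_exp] at this
    exact le_of_tendsto h hev

end Summit.KontsevichZagierPeriods.Zeta5Search.RayH1
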